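import Literature.Barriers.BirchSwinnertonDyer.RankNotSumOfLocalInvariantsProofs
import Literature.NumberTheory.EllipticCurves.QuadraticTwist
import Literature.NumberTheory.EllipticCurves.TwoDescentRankBounds
import Literature.NumberTheory.EllipticCurves.KramerTwoDescentSquares
import HarnessLib

/-!
# `rk E(F₄)` for `E = 480a1`, IV: rational points of infinite order on `E` and its twists by
# `-41`, `-73`

T. Dokchitser–V. Dokchitser, *A note on the Mordell–Weil rank modulo `n`*, J. Number Theory 131
(2011) 1833–1839 (arXiv:0910.4588), proof of Thm. 2, assert "2-descent shows that `rk E/ℚ = 1` and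
`rk E/F₄ = 6`" for `E = 480a1 : y² = x(x+2)(x-3)` (tree `curve480a1`) and
`F₄ = ℚ(√-1, √41, √73)`. Since `rk E(F₄) = Σ_d rk E^{(d)}(ℚ)` over the eight quadratic twists
`E^{(d)} : y² = x³ - d x² - 6 d² x = x (x + 2d)(x - 3d)`, `d ∈ {±1, ±41, ±73, ±2993}`
(`curve480a1.quadraticTwist d`; the decomposition is carried out in
`RankNotSumOfLocalInvariantsF4TwistsQ.lean`), the LOWER bound `rk E(F₄) ≥ 6` amounts to six
independent rational points on the twists. This file PROVES the first three lower bounds,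

* `one_le_mordellWeilRank_480a1 : 1 ≤ rk E(ℚ)` (the point `(-1, 2)`),
* `one_le_mordellWeilRank_neg41 : 1 ≤ rk E^{(-41)}(ℚ)` (the point `(722, 19760)`),
* `one_le_mordellWeilRank_neg73 : 1 ≤ rk E^{(-73)}(ℚ)`
  (the point `(-426996576/2468041, 6177277416456/3877292411)`),

the sequel `RankNotSumOfLocalInvariantsF4TwistPoints2993.lean` the other two (`rk E^{(2993)}(ℚ) ≥ 1`,
`rk E^{(-2993)}(ℚ) ≥ 2`). Infinite order / independence is certified by the complete `2`-descent
map `δ = (x - e₁, x - e₂) : E(ℚ) → ℚ*/ℚ*² × ℚ*/ℚ*²` (tree `twoDescentMap`, Silverman AEC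
Prop. X.1.4) followed by sign and valuation-parity characters of `ℚ*/ℚ*²` (tree `signHom`,
`parityHom`): by the tree's `linearIndependent_of_twoTorsion` (`TwoDescentRankBounds.lean`),
points whose character vectors are `𝔽₂`-independent of those of the `2`-torsion are
`ℤ`-independent, and by the Mordell–Weil theorem (tree `module_finite_point_holds`) this bounds
`WeierstrassCurve.mordellWeilRank = finrank_ℤ E(ℚ)` from below (`le_mordellWeilRank_of_twoTorsion`).

Also here, for all twists at once: the coefficients and the rational `2`-torsion
`e₁ = 0, e₂ = -2d, e₃ = 3d` of `E^{(d)}` (`splitTwoTorsion_twist`), its equation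
(`twist_nonsingular_iff`), the characters `χ ∘ δ₁`, `χ ∘ δ₂` (`charFst`, `charSnd`) and the
evaluation of `v_p` on explicit rationals (`padicValRat_eq_of_eq`, `parityBit_eq_of_eq`).

Design. Statements about rational points never spell out the group `E^{(d)}(ℚ)` with a fixed
`DecidableEq ℚ` instance: the definitions and value lemmas are polymorphic in `[DecidableEq ℚ]`,
and the rank statements use `WeierstrassCurve.mordellWeilRank`, which (like the tree's general-field
theorems `le_rank_of_twoTorsion`, `module_finite_point_holds`) carries the classical instance; the
proofs install it with `letI` (cf. the design notes of `QuadraticTwistRank.lean` and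
`Curve24A1Descent.lean`). `GHom M V` is `M →+ V` typed through `AddCommGroup V`, the form in
which `le_rank_of_twoTorsion` takes its character.

## References

* T. Dokchitser, V. Dokchitser, *A note on the Mordell–Weil rank modulo `n`*, J. Number Theory
  131 (2011) 1833–1839, arXiv:0910.4588, proof of Thm. 2. [DokchitserDokchitser2011RankModN]
* J. H. Silverman, *The Arithmetic of Elliptic Curves*, 2nd ed., GTM 106 (2009), Prop. X.1.4,
  Thm. VIII.6.7. [SilvermanAEC2009]
-/

noncomputable section

open scoped Classical

open WeierstrassCurve WeierstrassCurve.Affine WeierstrassCurve.Affine.Point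

namespace Literature.Barriers.BirchSwinnertonDyer

namespace DokchitserDokchitser2011

open Literature.NumberTheory.EllipticCurves.KramerTwoDescent

/-! ### The quadratic twists `E^{(d)} : y² = x³ - d x² - 6 d² x = x (x + 2d)(x - 3d)` of `480a1` -/

section Twist

variable (d : ℚ)

/-- `a₁(E^{(d)}) = 0`. [folklore] -/
@[simp] theorem twist_a₁ : (curve480a1.quadraticTwist d).a₁ = 0 := rfl

/-- `a₂(E^{(d)}) = -d`. [folklore] -/
@[simp] theorem twist_a₂ : (curve480a1.quadraticTwist d).a₂ = -d := by
  rw [quadraticTwist_a₂, b₂]; simp [curve480a1]; ring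

/-- `a₃(E^{(d)}) = 0`. [folklore] -/
@[simp] theorem twist_a₃ : (curve480a1.quadraticTwist d).a₃ = 0 := rfl

/-- `a₄(E^{(d)}) = -6d²`. [folklore] -/
@[simp] theorem twist_a₄ : (curve480a1.quadraticTwist d).a₄ = -6 * d ^ 2 := by
  rw [quadraticTwist_a₄, b₄]; simp [curve480a1]; ring

/-- `a₆(E^{(d)}) = 0`. [folklore] -/
@[simp] theorem twist_a₆ : (curve480a1.quadraticTwist d).a₆ = 0 := by
  rw [quadraticTwist_a₆, b₆]; simp [curve480a1]

/-- **`E^{(d)}` has rational `2`-torsion `e₁ = 0, e₂ = -2d, e₃ = 3d`**: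
`x³ - d x² - 6d² x = x (x + 2d)(x - 3d)`. [folklore] -/
theorem splitTwoTorsion_twist :
    (curve480a1.quadraticTwist d).toAffine.SplitTwoTorsion 0 (-2 * d) (3 * d) where
  b₂_eq := by
    rw [show (curve480a1.quadraticTwist d).toAffine.b₂ = (curve480a1.quadraticTwist d).b₂ from rfl,
      b₂, twist_a₁, twist_a₂]; ring
  b₄_eq := by
    rw [show (curve480a1.quadraticTwist d).toAffine.b₄ = (curve480a1.quadraticTwist d).b₄ from rfl,
      b₄, twist_a₁, twist_a₃, twist_a₄]; ring
  b₆_eq := by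
    rw [show (curve480a1.quadraticTwist d).toAffine.b₆ = (curve480a1.quadraticTwist d).b₆ from rfl,
      b₆, twist_a₃, twist_a₆]; ring

/-- The equation of `E^{(d)}`: `y² = x³ - d x² - 6 d² x`. [folklore] -/
theorem twist_equation_iff (x y : ℚ) :
    (curve480a1.quadraticTwist d).toAffine.Equation x y ↔
      y ^ 2 = x ^ 3 - d * x ^ 2 - 6 * d ^ 2 * x := by
  rw [WeierstrassCurve.Affine.equation_iff]
  simp only [show (curve480a1.quadraticTwist d).toAffine.a₁ = 0 from twist_a₁ d,
    show (curve480a1.quadraticTwist d).toAffine.a₂ = -d from twist_a₂ d,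
    show (curve480a1.quadraticTwist d).toAffine.a₃ = 0 from twist_a₃ d,
    show (curve480a1.quadraticTwist d).toAffine.a₄ = -6 * d ^ 2 from twist_a₄ d,
    show (curve480a1.quadraticTwist d).toAffine.a₆ = 0 from twist_a₆ d]
  constructor <;> intro h <;> linear_combination h

/-- `E^{(d)}` is an elliptic curve for `d ≠ 0` (`Δ = d⁶ Δ(E)`). [folklore] -/
theorem isElliptic_twist {d : ℚ} (hd : d ≠ 0) : (curve480a1.quadraticTwist d).IsElliptic :=
  isElliptic_quadraticTwist _ hd

/-- Nonsingularity on `E^{(d)}`, `d ≠ 0`, is the equation `y² = x³ - d x² - 6 d² x`. [folklore] -/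
theorem twist_nonsingular_iff {d : ℚ} (hd : d ≠ 0) (x y : ℚ) :
    (curve480a1.quadraticTwist d).toAffine.Nonsingular x y ↔
      y ^ 2 = x ^ 3 - d * x ^ 2 - 6 * d ^ 2 * x := by
  haveI := isElliptic_twist hd
  rw [← WeierstrassCurve.Affine.equation_iff_nonsingular, twist_equation_iff]

end Twist

/-- `E^{(-41)}` is an elliptic curve. [folklore] -/
instance isElliptic_twist_neg41 : (curve480a1.quadraticTwist (-41)).IsElliptic :=
  isElliptic_twist (by norm_num)

/-- `E^{(-73)}` is an elliptic curve. [folklore] -/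
instance isElliptic_twist_neg73 : (curve480a1.quadraticTwist (-73)).IsElliptic :=
  isElliptic_twist (by norm_num)

/-- `E^{(2993)}` is an elliptic curve. [folklore] -/
instance isElliptic_twist_2993 : (curve480a1.quadraticTwist 2993).IsElliptic :=
  isElliptic_twist (by norm_num)

/-- `E^{(-2993)}` is an elliptic curve. [folklore] -/
instance isElliptic_twist_neg2993 : (curve480a1.quadraticTwist (-2993)).IsElliptic :=
  isElliptic_twist (by norm_num)

/-- Rational `2`-torsion `0, -2, 3` of `E = 480a1 : y² = x (x + 2)(x - 3)` itself. [folklore] -/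
theorem splitTwoTorsion_480a1 : curve480a1.toAffine.SplitTwoTorsion 0 (-2) 3 where
  b₂_eq := by rw [show curve480a1.toAffine.b₂ = curve480a1.b₂ from rfl, b₂]; norm_num [curve480a1]
  b₄_eq := by rw [show curve480a1.toAffine.b₄ = curve480a1.b₄ from rfl, b₄]; norm_num [curve480a1]
  b₆_eq := by rw [show curve480a1.toAffine.b₆ = curve480a1.b₆ from rfl, b₆]; norm_num [curve480a1]

/-- Nonsingularity on `E = 480a1` is the equation `y² = x³ - x² - 6x`. [folklore] -/
theorem nonsingular_480a1_iff (x y : ℚ) :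
    curve480a1.toAffine.Nonsingular x y ↔ y ^ 2 = x ^ 3 - x ^ 2 - 6 * x := by
  rw [← WeierstrassCurve.Affine.equation_iff_nonsingular, WeierstrassCurve.Affine.equation_iff]
  simp only [show curve480a1.toAffine.a₁ = 0 from rfl, show curve480a1.toAffine.a₂ = -1 from rfl,
    show curve480a1.toAffine.a₃ = 0 from rfl, show curve480a1.toAffine.a₄ = -6 from rfl,
    show curve480a1.toAffine.a₆ = 0 from rfl]
  constructor <;> intro h <;> linear_combination h

/-! ### From `2`-descent characters to lower bounds for `mordellWeilRank` -/

/-- `M →+ V` with the additive structure of `V` read off from `AddCommGroup V` — the form in which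
the tree's `le_rank_of_twoTorsion` / `linearIndependent_of_twoTorsion` take their character `ψ`;
the characters below are typed this way so that their values rewrite inside those hypotheses.
[folklore] -/
abbrev GHom (M V : Type*) [AddZeroClass M] [AddCommGroup V] : Type _ := M →+ V

/-- **Lower bounds for the Mordell–Weil rank from the `2`-descent.** Over a number field `K`, for an
elliptic curve with rational `2`-torsion `e₁, e₂, e₃` and an additive `ψ : E(K) → V` into a
`ℤ/2`-vector space with `ψ T₃ = ψ T₁ + ψ T₂`: if the values `ψ P₁, …, ψ P_r, ψ T₁, ψ T₂` are
`ℤ/2`-linearly independent then `r ≤ rank_ℤ E(K)` — the tree's `linearIndependent_of_twoTorsion`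
(Silverman AEC Prop. X.1.4) made honest (`Module.finrank`) by the Mordell–Weil theorem
(`WeierstrassCurve.module_finite_point_holds`, AEC VIII.6.7). [cite: SilvermanAEC2009, Prop. X.1.4] -/
theorem le_mordellWeilRank_of_twoTorsion {K : Type*} [Field K] [NumberField K]
    {W : WeierstrassCurve K} [W.IsElliptic] {e₁ e₂ e₃ : K}
    (h : W.toAffine.SplitTwoTorsion e₁ e₂ e₃) {V : Type*} [AddCommGroup V] [Module (ZMod 2) V]
    (ψ : W.toAffine.Point →+ V) {r : ℕ} (P : Fin r → W.toAffine.Point)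
    (h₃ : ψ (.some _ _ (nonsingular_twoTorsion h.swap₂₃.swap₁₂)) =
      ψ (.some _ _ (nonsingular_twoTorsion h)) + ψ (.some _ _ (nonsingular_twoTorsion h.swap₁₂)))
    (hind : ∀ (c : Fin r → ZMod 2) (ε₁ ε₂ : ZMod 2),
      ∑ i, c i • ψ (P i) + ε₁ • ψ (.some _ _ (nonsingular_twoTorsion h)) +
        ε₂ • ψ (.some _ _ (nonsingular_twoTorsion h.swap₁₂)) = 0 → c = 0 ∧ ε₁ = 0 ∧ ε₂ = 0) :
    r ≤ W.mordellWeilRank := by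
  haveI : Module.Finite ℤ W.toAffine.Point := W.module_finite_point_holds
  have hli := (linearIndependent_of_twoTorsion h ψ P h₃ hind).fintype_card_le_finrank
  rw [Fintype.card_fin] at hli
  unfold WeierstrassCurve.mordellWeilRank
  exact hli

section Characters

variable {W : Affine ℚ} {e₁ e₂ e₃ : ℚ} [W.IsElliptic] [DecidableEq ℚ]

/-- `χ ∘ δ₁`: a character `χ` of `ℚ*/ℚ*²` composed with the first component `δ₁ = x - e₁` of the
complete `2`-descent map (tree `twoDescentMap`, Silverman AEC Prop. X.1.4). [folklore] -/
def charFst (h : W.SplitTwoTorsion e₁ e₂ e₃) (χ : Additive (SqUnits ℚ) →+ ZMod 2) :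
    W.Point →+ ZMod 2 :=
  χ.comp ((MonoidHom.toAdditive (MonoidHom.fst (SqUnits ℚ) (SqUnits ℚ))).comp (twoDescentMap h))

/-- `χ ∘ δ₂`, the same with the second component `δ₂ = x - e₂`. [folklore] -/
def charSnd (h : W.SplitTwoTorsion e₁ e₂ e₃) (χ : Additive (SqUnits ℚ) →+ ZMod 2) :
    W.Point →+ ZMod 2 :=
  χ.comp ((MonoidHom.toAdditive (MonoidHom.snd (SqUnits ℚ) (SqUnits ℚ))).comp (twoDescentMap h))

/-- `(χ ∘ δ₁)(P) = χ(δ₁ P)`. [folklore] -/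
theorem charFst_apply (h : W.SplitTwoTorsion e₁ e₂ e₃) (χ : Additive (SqUnits ℚ) →+ ZMod 2)
    (P : W.Point) :
    charFst h χ P = χ (Additive.ofMul (twoDescentComponent W e₁ e₂ e₃ P)) := by
  simp [charFst, twoDescentMap_apply]

/-- `(χ ∘ δ₂)(P) = χ(δ₂ P)`. [folklore] -/
theorem charSnd_apply (h : W.SplitTwoTorsion e₁ e₂ e₃) (χ : Additive (SqUnits ℚ) →+ ZMod 2)
    (P : W.Point) :
    charSnd h χ P = χ (Additive.ofMul (twoDescentComponent W e₂ e₁ e₃ P)) := by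
  simp [charSnd, twoDescentMap_apply]

end Characters

/-! ### Sign and valuation-parity of explicit rationals -/

/-- `v_p(± p^k u / v) = k` for `p ∤ u v`. [folklore] -/
theorem padicValRat_eq_of_eq {p : ℕ} [hp : Fact p.Prime] {a : ℚ} (k : ℕ) {u v : ℕ} (s : ℤ)
    (hs : s = 1 ∨ s = -1) (hu : ¬ p ∣ u) (hv : ¬ p ∣ v)
    (h : a = s * (p : ℚ) ^ k * u / v) : padicValRat p a = k := by
  have hu0 : u ≠ 0 := by rintro rfl; exact hu (dvd_zero p)
  have hv0 : v ≠ 0 := by rintro rfl; exact hv (dvd_zero p)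
  have hp0 : (p : ℚ) ≠ 0 := Nat.cast_ne_zero.mpr hp.out.ne_zero
  have hs0 : (s : ℚ) ≠ 0 := by rcases hs with rfl | rfl <;> norm_num
  have hsv : padicValRat p (s : ℚ) = 0 := by
    rcases hs with rfl | rfl
    · simp
    · rw [Int.cast_neg, Int.cast_one, padicValRat.neg, padicValRat.one]
  rw [h, padicValRat.div (mul_ne_zero (mul_ne_zero hs0 (pow_ne_zero _ hp0))
      (Nat.cast_ne_zero.mpr hu0)) (Nat.cast_ne_zero.mpr hv0),
    padicValRat.mul (mul_ne_zero hs0 (pow_ne_zero _ hp0)) (Nat.cast_ne_zero.mpr hu0),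
    padicValRat.mul hs0 (pow_ne_zero _ hp0), hsv, padicValRat.pow (p : ℚ),
    padicValRat.self hp.out.one_lt, padicValRat.of_nat, padicValRat.of_nat,
    padicValNat.eq_zero_of_not_dvd hu, padicValNat.eq_zero_of_not_dvd hv]
  simp

/-- Parity of `v_p(± p^k u / v)` for `p ∤ u v`: the value of the tree's character `parityBit p`.
[folklore] -/
theorem parityBit_eq_of_eq (p : ℕ) [Fact p.Prime] {a : ℚ} (k : ℕ) {u v : ℕ} (s : ℤ)
    (hs : s = 1 ∨ s = -1) (hu : ¬ p ∣ u) (hv : ¬ p ∣ v)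
    (h : a = s * (p : ℚ) ^ k * u / v) : parityBit p a = (k : ZMod 2) := by
  rw [parityBit, padicValRat_eq_of_eq k s hs hu hv h, Int.cast_natCast]

/-- Parity of `v_p(± u / (p^k v))` for `p ∤ u v` (negative valuations). [folklore] -/
theorem parityBit_eq_of_eq_div (p : ℕ) [hp : Fact p.Prime] {a : ℚ} (k : ℕ) {u v : ℕ} (s : ℤ)
    (hs : s = 1 ∨ s = -1) (hu : ¬ p ∣ u) (hv : ¬ p ∣ v)
    (h : a = s * u / ((p : ℚ) ^ k * v)) : parityBit p a = (k : ZMod 2) := by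
  have hu0 : u ≠ 0 := by rintro rfl; exact hu (dvd_zero p)
  have hp0 : (p : ℚ) ≠ 0 := Nat.cast_ne_zero.mpr hp.out.ne_zero
  have hs0 : (s : ℚ) ≠ 0 := by rcases hs with rfl | rfl <;> norm_num
  have hs2 : (s : ℚ) * s = 1 := by rcases hs with rfl | rfl <;> norm_num
  have hinv : a⁻¹ = s * (p : ℚ) ^ k * v / u := by
    rw [h, inv_div, div_eq_div_iff (mul_ne_zero hs0 (Nat.cast_ne_zero.mpr hu0))
      (Nat.cast_ne_zero.mpr hu0)]
    linear_combination (-((p : ℚ) ^ k * (v : ℚ) * (u : ℚ))) * hs2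
  have hval : padicValRat p a⁻¹ = k := padicValRat_eq_of_eq k s hs hv hu hinv
  rw [padicValRat.inv] at hval
  rw [parityBit, show padicValRat p a = -(k : ℤ) by omega, Int.cast_neg, Int.cast_natCast,
    ZModModule.neg_eq_self]

/-- The sign character on a negative rational. [folklore] -/
theorem signBit_of_neg {a : ℚ} (ha : a < 0) : signBit a = 1 := by rw [signBit, if_pos ha]

/-- The sign character on a non-negative rational. [folklore] -/
theorem signBit_of_nonneg {a : ℚ} (ha : 0 ≤ a) : signBit a = 0 := by
  rw [signBit, if_neg (not_lt.mpr ha)]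

/-- `41` is prime (instance for `parityHom 41`). [folklore] -/
instance fact_prime_41 : Fact (Nat.Prime 41) := ⟨by norm_num⟩

/-- `73` is prime (instance for `parityHom 73`). [folklore] -/
instance fact_prime_73 : Fact (Nat.Prime 73) := ⟨by norm_num⟩

/-- Independence of three vectors of `𝔽₂³` from a vanishing `3 × 3` determinant check, in the
form consumed by `le_mordellWeilRank_of_twoTorsion` with `r = 1`. [folklore] -/
theorem indep_fin_one {V : Type*} [AddCommGroup V] [Module (ZMod 2) V] {p t₁ t₂ : V}
    (key : ∀ a ε₁ ε₂ : ZMod 2, a • p + ε₁ • t₁ + ε₂ • t₂ = 0 → a = 0 ∧ ε₁ = 0 ∧ ε₂ = 0)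
    {f : Fin 1 → V} (hf : f 0 = p) (c : Fin 1 → ZMod 2) (ε₁ ε₂ : ZMod 2)
    (hc : ∑ i, c i • f i + ε₁ • t₁ + ε₂ • t₂ = 0) : c = 0 ∧ ε₁ = 0 ∧ ε₂ = 0 := by
  rw [Fin.sum_univ_one, hf] at hc
  obtain ⟨h0, h1, h2⟩ := key (c 0) ε₁ ε₂ hc
  exact ⟨funext fun i => by rw [Subsingleton.elim i 0]; exact h0, h1, h2⟩

/-! ### `E(ℚ)`: the point `(-1, 2)` -/

/-- The rational point `P₀ = (-1, 2)` of `E = 480a1` (Cremona's generator). [folklore] -/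
def pt480a1 : curve480a1.toAffine.Point :=
  .some (-1) 2 ((nonsingular_480a1_iff _ _).mpr (by norm_num))

section E480a1

variable [DecidableEq ℚ]

/-- The character `(sign δ₁, v₂ δ₁, v₃ δ₁)` of `E(ℚ)`. [folklore] -/
def ψ480a1 : GHom curve480a1.toAffine.Point (ZMod 2 × ZMod 2 × ZMod 2) :=
  (charFst splitTwoTorsion_480a1 signHom).prod
    ((charFst splitTwoTorsion_480a1 (parityHom 2)).prod (charFst splitTwoTorsion_480a1 (parityHom 3)))

/-- `ψ(P₀) = (1, 0, 0)` (`δ₁(P₀) = [-1]`). [folklore] -/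
theorem ψ480a1_pt : ψ480a1 pt480a1 = (1, 0, 0) := by
  have hx : (-1 : ℚ) - 0 ≠ 0 := by norm_num
  simp only [ψ480a1, AddMonoidHom.prod_apply, charFst_apply, pt480a1,
    twoDescentComponent_some_of_ne _ (show (-1 : ℚ) ≠ 0 by norm_num), signHom_sqClass hx,
    parityHom_sqClass hx]
  refine Prod.ext (signBit_of_neg (by norm_num)) (Prod.ext ?_ ?_)
  · exact parityBit_eq_of_eq 2 0 (u := 1) (v := 1) (-1) (Or.inr rfl) (by norm_num) (by norm_num)
      (by norm_num)
  · exact parityBit_eq_of_eq 3 0 (u := 1) (v := 1) (-1) (Or.inr rfl) (by norm_num) (by norm_num)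
      (by norm_num)

/-- `ψ(T₁) = (1, 1, 1)` (`δ₁(T₁) = [(0+2)(0-3)] = [-6]`). [folklore] -/
theorem ψ480a1_T₁ : ψ480a1 (.some _ _ (nonsingular_twoTorsion splitTwoTorsion_480a1)) = (1, 1, 1) := by
  have hx : ((0 : ℚ) - -2) * (0 - 3) ≠ 0 := by norm_num
  simp only [ψ480a1, AddMonoidHom.prod_apply, charFst_apply,
    twoDescentComponent_some_of_eq _ rfl, signHom_sqClass hx, parityHom_sqClass hx]
  refine Prod.ext (signBit_of_neg (by norm_num)) (Prod.ext ?_ ?_)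
  · exact parityBit_eq_of_eq 2 1 (u := 3) (v := 1) (-1) (Or.inr rfl) (by norm_num) (by norm_num)
      (by norm_num)
  · exact parityBit_eq_of_eq 3 1 (u := 2) (v := 1) (-1) (Or.inr rfl) (by norm_num) (by norm_num)
      (by norm_num)

/-- `ψ(T₂) = (1, 1, 0)` (`δ₁(T₂) = [-2]`). [folklore] -/
theorem ψ480a1_T₂ :
    ψ480a1 (.some _ _ (nonsingular_twoTorsion splitTwoTorsion_480a1.swap₁₂)) = (1, 1, 0) := by
  have hx : (-2 : ℚ) - 0 ≠ 0 := by norm_num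
  simp only [ψ480a1, AddMonoidHom.prod_apply, charFst_apply,
    twoDescentComponent_some_of_ne _ (show (-2 : ℚ) ≠ 0 by norm_num), signHom_sqClass hx,
    parityHom_sqClass hx]
  refine Prod.ext (signBit_of_neg (by norm_num)) (Prod.ext ?_ ?_)
  · exact parityBit_eq_of_eq 2 1 (u := 1) (v := 1) (-1) (Or.inr rfl) (by norm_num) (by norm_num)
      (by norm_num)
  · exact parityBit_eq_of_eq 3 0 (u := 2) (v := 1) (-1) (Or.inr rfl) (by norm_num) (by norm_num)
      (by norm_num)

/-- `ψ(T₃) = (0, 0, 1)` (`δ₁(T₃) = [3]`). [folklore] -/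
theorem ψ480a1_T₃ :
    ψ480a1 (.some _ _ (nonsingular_twoTorsion splitTwoTorsion_480a1.swap₂₃.swap₁₂)) = (0, 0, 1) := by
  have hx : (3 : ℚ) - 0 ≠ 0 := by norm_num
  simp only [ψ480a1, AddMonoidHom.prod_apply, charFst_apply,
    twoDescentComponent_some_of_ne _ (show (3 : ℚ) ≠ 0 by norm_num), signHom_sqClass hx,
    parityHom_sqClass hx]
  refine Prod.ext (signBit_of_nonneg (by norm_num)) (Prod.ext ?_ ?_)
  · exact parityBit_eq_of_eq 2 0 (u := 3) (v := 1) 1 (Or.inl rfl) (by norm_num) (by norm_num)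
      (by norm_num)
  · exact parityBit_eq_of_eq 3 1 (u := 1) (v := 1) 1 (Or.inl rfl) (by norm_num) (by norm_num)
      (by norm_num)

end E480a1

/-- **`1 ≤ rk E(ℚ)`** for `E = 480a1`: `P₀ = (-1, 2)` has infinite order, by the characters
`(sign, v₂, v₃) ∘ δ₁` (`ψ P₀ = (1,0,0)`, `ψ T₁ = (1,1,1)`, `ψ T₂ = (1,1,0)` independent). Cremona's
table gives rank exactly `1`; the tree's `curve480a1.not_isOfFinAddOrder_basePoint` proves the
infinite order by a `2`-power-torsion argument on `E ⊗ ℚ`.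
[cite: DokchitserDokchitser2011RankModN, proof of Thm. 2] -/
theorem one_le_mordellWeilRank_480a1 : 1 ≤ curve480a1.mordellWeilRank := by
  letI : DecidableEq ℚ := fun a b => Classical.propDecidable (a = b)
  have key : ∀ a ε₁ ε₂ : ZMod 2, a • ((1 : ZMod 2), (0 : ZMod 2), (0 : ZMod 2)) +
      ε₁ • ((1 : ZMod 2), (1 : ZMod 2), (1 : ZMod 2)) +
      ε₂ • ((1 : ZMod 2), (1 : ZMod 2), (0 : ZMod 2)) = 0 → a = 0 ∧ ε₁ = 0 ∧ ε₂ = 0 := by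
    decide
  have h := le_mordellWeilRank_of_twoTorsion splitTwoTorsion_480a1 ψ480a1 ![pt480a1] ?_ ?_
  · exact h
  · rw [ψ480a1_T₁, ψ480a1_T₂, ψ480a1_T₃]; decide
  · intro c ε₁ ε₂ hc
    rw [ψ480a1_T₁, ψ480a1_T₂] at hc
    exact indep_fin_one key (f := fun i => ψ480a1 (![pt480a1] i)) ψ480a1_pt c ε₁ ε₂ hc

/-! ### `E^{(-41)}`: the point `(722, 19760)` -/

/-- Rational `2`-torsion `0, 82, -123` of `E^{(-41)} : y² = x (x - 82)(x + 123)`. [folklore] -/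
theorem splitTwoTorsion_neg41 :
    (curve480a1.quadraticTwist (-41)).toAffine.SplitTwoTorsion 0 82 (-123) := by
  have h := splitTwoTorsion_twist (-41)
  norm_num at h
  exact h

/-- The rational point `(722, 19760)` of `E^{(-41)}` (`19760² = 722 · 640 · 845`). [folklore] -/
def ptNeg41 : (curve480a1.quadraticTwist (-41)).toAffine.Point :=
  .some 722 19760 ((twist_nonsingular_iff (by norm_num) _ _).mpr (by norm_num))

section Neg41

variable [DecidableEq ℚ]

/-- The character `(sign δ₁, v₂ δ₁, v₄₁ δ₁)` of `E^{(-41)}(ℚ)`. [folklore] -/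
def ψNeg41 : GHom (curve480a1.quadraticTwist (-41)).toAffine.Point (ZMod 2 × ZMod 2 × ZMod 2) :=
  (charFst splitTwoTorsion_neg41 signHom).prod
    ((charFst splitTwoTorsion_neg41 (parityHom 2)).prod
      (charFst splitTwoTorsion_neg41 (parityHom 41)))

/-- `ψ(722, 19760) = (0, 1, 0)` (`δ₁ = [722] = [2]`). [folklore] -/
theorem ψNeg41_pt : ψNeg41 ptNeg41 = (0, 1, 0) := by
  have hx : (722 : ℚ) - 0 ≠ 0 := by norm_num
  simp only [ψNeg41, AddMonoidHom.prod_apply, charFst_apply, ptNeg41,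
    twoDescentComponent_some_of_ne _ (show (722 : ℚ) ≠ 0 by norm_num), signHom_sqClass hx,
    parityHom_sqClass hx]
  refine Prod.ext (signBit_of_nonneg (by norm_num)) (Prod.ext ?_ ?_)
  · exact parityBit_eq_of_eq 2 1 (u := 361) (v := 1) 1 (Or.inl rfl) (by norm_num) (by norm_num)
      (by norm_num)
  · exact parityBit_eq_of_eq 41 0 (u := 722) (v := 1) 1 (Or.inl rfl) (by norm_num) (by norm_num)
      (by norm_num)

/-- `ψ(T₁) = (1, 1, 0)` (`δ₁(T₁) = [(0-82)(0+123)] = [-10086] = [-6]`). [folklore] -/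
theorem ψNeg41_T₁ : ψNeg41 (.some _ _ (nonsingular_twoTorsion splitTwoTorsion_neg41)) = (1, 1, 0) := by
  have hx : ((0 : ℚ) - 82) * (0 - -123) ≠ 0 := by norm_num
  simp only [ψNeg41, AddMonoidHom.prod_apply, charFst_apply,
    twoDescentComponent_some_of_eq _ rfl, signHom_sqClass hx, parityHom_sqClass hx]
  refine Prod.ext (signBit_of_neg (by norm_num)) (Prod.ext ?_ ?_)
  · exact parityBit_eq_of_eq 2 1 (u := 5043) (v := 1) (-1) (Or.inr rfl) (by norm_num) (by norm_num)
      (by norm_num)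
  · exact parityBit_eq_of_eq 41 2 (u := 6) (v := 1) (-1) (Or.inr rfl) (by norm_num) (by norm_num)
      (by norm_num)

/-- `ψ(T₂) = (0, 1, 1)` (`δ₁(T₂) = [82]`). [folklore] -/
theorem ψNeg41_T₂ :
    ψNeg41 (.some _ _ (nonsingular_twoTorsion splitTwoTorsion_neg41.swap₁₂)) = (0, 1, 1) := by
  have hx : (82 : ℚ) - 0 ≠ 0 := by norm_num
  simp only [ψNeg41, AddMonoidHom.prod_apply, charFst_apply,
    twoDescentComponent_some_of_ne _ (show (82 : ℚ) ≠ 0 by norm_num), signHom_sqClass hx,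
    parityHom_sqClass hx]
  refine Prod.ext (signBit_of_nonneg (by norm_num)) (Prod.ext ?_ ?_)
  · exact parityBit_eq_of_eq 2 1 (u := 41) (v := 1) 1 (Or.inl rfl) (by norm_num) (by norm_num)
      (by norm_num)
  · exact parityBit_eq_of_eq 41 1 (u := 2) (v := 1) 1 (Or.inl rfl) (by norm_num) (by norm_num)
      (by norm_num)

/-- `ψ(T₃) = (1, 0, 1)` (`δ₁(T₃) = [-123]`). [folklore] -/
theorem ψNeg41_T₃ :
    ψNeg41 (.some _ _ (nonsingular_twoTorsion splitTwoTorsion_neg41.swap₂₃.swap₁₂)) = (1, 0, 1) := by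
  have hx : (-123 : ℚ) - 0 ≠ 0 := by norm_num
  simp only [ψNeg41, AddMonoidHom.prod_apply, charFst_apply,
    twoDescentComponent_some_of_ne _ (show (-123 : ℚ) ≠ 0 by norm_num), signHom_sqClass hx,
    parityHom_sqClass hx]
  refine Prod.ext (signBit_of_neg (by norm_num)) (Prod.ext ?_ ?_)
  · exact parityBit_eq_of_eq 2 0 (u := 123) (v := 1) (-1) (Or.inr rfl) (by norm_num) (by norm_num)
      (by norm_num)
  · exact parityBit_eq_of_eq 41 1 (u := 3) (v := 1) (-1) (Or.inr rfl) (by norm_num) (by norm_num)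
      (by norm_num)

end Neg41

/-- **`1 ≤ rk E^{(-41)}(ℚ)`**: `(722, 19760)` has infinite order, by the characters
`(sign, v₂, v₄₁) ∘ δ₁` (`ψ P = (0,1,0)`, `ψ T₁ = (1,1,0)`, `ψ T₂ = (0,1,1)` independent).
[cite: DokchitserDokchitser2011RankModN, proof of Thm. 2] -/
theorem one_le_mordellWeilRank_neg41 : 1 ≤ (curve480a1.quadraticTwist (-41)).mordellWeilRank := by
  letI : DecidableEq ℚ := fun a b => Classical.propDecidable (a = b)
  have key : ∀ a ε₁ ε₂ : ZMod 2, a • ((0 : ZMod 2), (1 : ZMod 2), (0 : ZMod 2)) +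
      ε₁ • ((1 : ZMod 2), (1 : ZMod 2), (0 : ZMod 2)) +
      ε₂ • ((0 : ZMod 2), (1 : ZMod 2), (1 : ZMod 2)) = 0 → a = 0 ∧ ε₁ = 0 ∧ ε₂ = 0 := by
    decide
  have h := le_mordellWeilRank_of_twoTorsion splitTwoTorsion_neg41 ψNeg41 ![ptNeg41] ?_ ?_
  · exact h
  · rw [ψNeg41_T₁, ψNeg41_T₂, ψNeg41_T₃]; decide
  · intro c ε₁ ε₂ hc
    rw [ψNeg41_T₁, ψNeg41_T₂] at hc
    exact indep_fin_one key (f := fun i => ψNeg41 (![ptNeg41] i)) ψNeg41_pt c ε₁ ε₂ hc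

/-! ### `E^{(-73)}`: the point `(-426996576/2468041, 6177277416456/3877292411)` -/

/-- Rational `2`-torsion `0, 146, -219` of `E^{(-73)} : y² = x (x - 146)(x + 219)`. [folklore] -/
theorem splitTwoTorsion_neg73 :
    (curve480a1.quadraticTwist (-73)).toAffine.SplitTwoTorsion 0 146 (-219) := by
  have h := splitTwoTorsion_twist (-73)
  norm_num at h
  exact h

/-- The rational point `(-6 (8436/1571)², 6177277416456/3877292411)` of `E^{(-73)}` (found on the
homogeneous space `δ = ([-6], [-2])` of the `2`-descent). [folklore] -/
def ptNeg73 : (curve480a1.quadraticTwist (-73)).toAffine.Point :=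
  .some (-426996576 / 2468041) (6177277416456 / 3877292411)
    ((twist_nonsingular_iff (by norm_num) _ _).mpr (by norm_num))

section Neg73

variable [DecidableEq ℚ]

/-- The character `(sign δ₁, v₂ δ₁, v₇₃ δ₂)` of `E^{(-73)}(ℚ)`. [folklore] -/
def ψNeg73 : GHom (curve480a1.quadraticTwist (-73)).toAffine.Point (ZMod 2 × ZMod 2 × ZMod 2) :=
  (charFst splitTwoTorsion_neg73 signHom).prod
    ((charFst splitTwoTorsion_neg73 (parityHom 2)).prod
      (charSnd splitTwoTorsion_neg73 (parityHom 73)))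

/-- `ψ(P) = (1, 1, 0)` (`δ(P) = ([-2⁵ · 13343643 / 1571²], [-2 · 19841² / 1571²])`). [folklore] -/
theorem ψNeg73_pt : ψNeg73 ptNeg73 = (1, 1, 0) := by
  have hx : (-426996576 / 2468041 : ℚ) - 0 ≠ 0 := by norm_num
  have hx' : (-426996576 / 2468041 : ℚ) - 146 ≠ 0 := by norm_num
  simp only [ψNeg73, AddMonoidHom.prod_apply, charFst_apply, charSnd_apply, ptNeg73,
    twoDescentComponent_some_of_ne _ (show (-426996576 / 2468041 : ℚ) ≠ 0 by norm_num),
    twoDescentComponent_some_of_ne _ (show (-426996576 / 2468041 : ℚ) ≠ 146 by norm_num),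
    signHom_sqClass hx, parityHom_sqClass hx, parityHom_sqClass hx']
  refine Prod.ext (signBit_of_neg (by norm_num)) (Prod.ext ?_ ?_)
  · exact parityBit_eq_of_eq 2 5 (u := 13343643) (v := 2468041) (-1) (Or.inr rfl) (by norm_num)
      (by norm_num) (by norm_num)
  · exact parityBit_eq_of_eq 73 0 (u := 787330562) (v := 2468041) (-1) (Or.inr rfl) (by norm_num)
      (by norm_num) (by norm_num)

/-- `ψ(T₁) = (1, 1, 1)` (`δ(T₁) = ([-31974], [-146])`). [folklore] -/
theorem ψNeg73_T₁ : ψNeg73 (.some _ _ (nonsingular_twoTorsion splitTwoTorsion_neg73)) = (1, 1, 1) := by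
  have hx : ((0 : ℚ) - 146) * (0 - -219) ≠ 0 := by norm_num
  have hx' : (0 : ℚ) - 146 ≠ 0 := by norm_num
  simp only [ψNeg73, AddMonoidHom.prod_apply, charFst_apply, charSnd_apply,
    twoDescentComponent_some_of_eq _ rfl,
    twoDescentComponent_some_of_ne _ (show (0 : ℚ) ≠ 146 by norm_num), signHom_sqClass hx,
    parityHom_sqClass hx, parityHom_sqClass hx']
  refine Prod.ext (signBit_of_neg (by norm_num)) (Prod.ext ?_ ?_)
  · exact parityBit_eq_of_eq 2 1 (u := 15987) (v := 1) (-1) (Or.inr rfl) (by norm_num) (by norm_num)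
      (by norm_num)
  · exact parityBit_eq_of_eq 73 1 (u := 2) (v := 1) (-1) (Or.inr rfl) (by norm_num) (by norm_num)
      (by norm_num)

/-- `ψ(T₂) = (0, 1, 0)` (`δ(T₂) = ([146], [146 · 365])`). [folklore] -/
theorem ψNeg73_T₂ :
    ψNeg73 (.some _ _ (nonsingular_twoTorsion splitTwoTorsion_neg73.swap₁₂)) = (0, 1, 0) := by
  have hx : (146 : ℚ) - 0 ≠ 0 := by norm_num
  have hx' : ((146 : ℚ) - 0) * (146 - -219) ≠ 0 := by norm_num
  simp only [ψNeg73, AddMonoidHom.prod_apply, charFst_apply, charSnd_apply,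
    twoDescentComponent_some_of_ne _ (show (146 : ℚ) ≠ 0 by norm_num),
    twoDescentComponent_some_of_eq _ rfl, signHom_sqClass hx, parityHom_sqClass hx,
    parityHom_sqClass hx']
  refine Prod.ext (signBit_of_nonneg (by norm_num)) (Prod.ext ?_ ?_)
  · exact parityBit_eq_of_eq 2 1 (u := 73) (v := 1) 1 (Or.inl rfl) (by norm_num) (by norm_num)
      (by norm_num)
  · exact parityBit_eq_of_eq 73 2 (u := 10) (v := 1) 1 (Or.inl rfl) (by norm_num) (by norm_num)
      (by norm_num)

/-- `ψ(T₃) = (1, 0, 1)` (`δ(T₃) = ([-219], [-365])`). [folklore] -/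
theorem ψNeg73_T₃ :
    ψNeg73 (.some _ _ (nonsingular_twoTorsion splitTwoTorsion_neg73.swap₂₃.swap₁₂)) = (1, 0, 1) := by
  have hx : (-219 : ℚ) - 0 ≠ 0 := by norm_num
  have hx' : (-219 : ℚ) - 146 ≠ 0 := by norm_num
  simp only [ψNeg73, AddMonoidHom.prod_apply, charFst_apply, charSnd_apply,
    twoDescentComponent_some_of_ne _ (show (-219 : ℚ) ≠ 0 by norm_num),
    twoDescentComponent_some_of_ne _ (show (-219 : ℚ) ≠ 146 by norm_num), signHom_sqClass hx,
    parityHom_sqClass hx, parityHom_sqClass hx']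
  refine Prod.ext (signBit_of_neg (by norm_num)) (Prod.ext ?_ ?_)
  · exact parityBit_eq_of_eq 2 0 (u := 219) (v := 1) (-1) (Or.inr rfl) (by norm_num) (by norm_num)
      (by norm_num)
  · exact parityBit_eq_of_eq 73 1 (u := 5) (v := 1) (-1) (Or.inr rfl) (by norm_num) (by norm_num)
      (by norm_num)

end Neg73

/-- **`1 ≤ rk E^{(-73)}(ℚ)`**: `ptNeg73` has infinite order, by the characters
`(sign δ₁, v₂ δ₁, v₇₃ δ₂)` (`ψ P = (1,1,0)`, `ψ T₁ = (1,1,1)`, `ψ T₂ = (0,1,0)` independent).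
[cite: DokchitserDokchitser2011RankModN, proof of Thm. 2] -/
theorem one_le_mordellWeilRank_neg73 : 1 ≤ (curve480a1.quadraticTwist (-73)).mordellWeilRank := by
  letI : DecidableEq ℚ := fun a b => Classical.propDecidable (a = b)
  have key : ∀ a ε₁ ε₂ : ZMod 2, a • ((1 : ZMod 2), (1 : ZMod 2), (0 : ZMod 2)) +
      ε₁ • ((1 : ZMod 2), (1 : ZMod 2), (1 : ZMod 2)) +
      ε₂ • ((0 : ZMod 2), (1 : ZMod 2), (0 : ZMod 2)) = 0 → a = 0 ∧ ε₁ = 0 ∧ ε₂ = 0 := by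
    decide
  have h := le_mordellWeilRank_of_twoTorsion splitTwoTorsion_neg73 ψNeg73 ![ptNeg73] ?_ ?_
  · exact h
  · rw [ψNeg73_T₁, ψNeg73_T₂, ψNeg73_T₃]; decide
  · intro c ε₁ ε₂ hc
    rw [ψNeg73_T₁, ψNeg73_T₂] at hc
    exact indep_fin_one key (f := fun i => ψNeg73 (![ptNeg73] i)) ψNeg73_pt c ε₁ ε₂ hc

end DokchitserDokchitser2011

end Literature.Barriers.BirchSwinnertonDyer

end
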